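/-
Origin: expansion seat `prover-pub-hodgecm-mc-carch-1-g36-0`, handover #CA68 2026-08-21T01:56Z md5 e63809d3125f (120 l.; NEW additive leaf; imports Model.ArchKTypeOfMultOne + Model.AdelicThetaDistributionMult + Model.AdelicThetaDistributionOf34 (#1258, sinst-1-g11 RUN-69 row — CROSS-KIT ROWDEP); ns HodgeCM.Model.ThetaAdelicSide; 2 theorems 0 defs; NAMES for audit: HodgeCM.Model.ThetaAdelicSide.rank_admFamilies_thetaDistDatumTwoOf_le_one · HodgeCM.Model.ThetaAdelicSide.rank_admFamilies_thetaDistDatumThreeOf_le_one) (`HOME/mc/pub-hodgecm-mc-carch-1/stage69/HodgeCM/Model/ArchKTypeOfMultOneDatum34.lean`, md5 e63809d3125f, 120 lines);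
landed by the gen-29 packager (p-g29) in gate run 69 as `HodgeCM/Model/ArchKTypeOfMultOneDatum34.lean` (verbatim).
-/
/-
Copyright (c) 2026 the pub-hodgecm formalisation cell (harness21).  New file, not vendored.
Origin: session prover-pub-hodgecm-mc-carch-1-g36-0 (unit pub-hodgecm-mc-carch-1, C / ARCHDATUM BUILDER gen 36; (J4-mult1) for SLOTS 2 AND 3, DISCHARGED
at sinst-1's honest (J4) product Weil data `thetaDistDatumTwoOf/ThreeOf` (#1258)), 2026-08-21.
Intended final place: `HodgeCM/Model/ArchKTypeOfMultOneDatum34.lean` (NEW additive model-layer leaf; imports carch #CA64 `Model/ArchKTypeOfMultOne` (RUN 68)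
+ binder-1 #R123 `Model/AdelicThetaDistributionMult` (RUN 67, `admFamilies`) + sinst-1 #1258 `Model/AdelicThetaDistributionOf34` (RUN 69); nothing imports it; drop alone).
-/
import Summits.HodgeConjecture.HodgeCM.Model.ArchKTypeOfMultOne_2
import Summits.HodgeConjecture.HodgeCM.Model.AdelicThetaDistributionMult_2
import Summits.HodgeConjecture.HodgeCM.Model.AdelicThetaDistributionOf34

set_option autoImplicit false

/-!
# (J4-mult1) for slots 2 and 3: `hrk` for `thetaDistDatumTwoOf/ThreeOf … .admFamilies ωar`, for every `(ωar, har)`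

The slot-2/3 twin of #CA65 `Model/ArchKTypeOfMultOneDatum`: for EVERY archimedean operator datum `ωar` with
`har : ((archSideOf …).P k).ω ((aa)^𝔸, 1) = ωar aa ⊗ 1` on the `aa` trivial at the place of `ι₁` (binder-1's `archOpTwo/Three` with
#CA44 `lineRepOf_two/three_regime_archToAdelicG` is one such), the admissible archimedean families of `thetaDistDatumTwoOf/ThreeOf … Φ harm hdef`
have `ℂ`-rank at most one — #CA64 `rank_le_one_of_lineOmega_two/three` (`D.ωA = lineOmega_two/three …` and `((archSideOf …).P k).ω = lineRepOf … k` by `rfl`).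

* `rank_admFamilies_thetaDistDatumTwoOf_le_one`, `rank_admFamilies_thetaDistDatumThreeOf_le_one`.

KERNEL only: 0 defs, 0 records, nothing cited; `#print axioms` ⊆ {propext, Classical.choice, Quot.sound}.
-/

noncomputable section

open MeasureTheory MulAction IsDedekindDomain NumberField.mixedEmbedding
open NumberField hiding relNormOneIdeles relNormOneRat probHaarRelNormOneQuot
open scoped Matrix TensorProduct Classical SchwartzMap
open Literature.NumberTheory.Automorphic Literature.NumberTheory.Automorphic.UnitaryGroup Literature.NumberTheory.Weil1964
open Literature.NumberTheory.GelbartRogawski1991 Literature.NumberTheory.GelbartRogawski1991.UnitaryDualPair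
open Literature.Geometry.ComplexHyperbolic.BallModel (U21 x₀)
open Literature.AlgebraicGeometry.ShimuraVarieties
open HodgeCM.Adelic HodgeCM.PerL34 HodgeCM.Model.HypCensus HodgeCM.Model.ArchSideTerm HodgeCM.Model.ThetaDistFin

namespace HodgeCM.Model
namespace ThetaAdelicSide

section Honest34

variable {L : CMField} {ι₁ : L →+* ℂ} (V : HermSpace3 L ι₁) (c : SeesawCtx L)
  (hGR : (cmSplittingDatum (L : Type) finProdFinEquiv (frameD V) (frameD_real V) (frameD_ne V) (dW c.D) (dW_real c.D)
    (dW_ne c.D)).CompatibleSplitting)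
  (hGR₀ : (cmSplittingDatum (L : Type) (e₁) (frameD V) (frameD_real V) (frameD_ne V) (lineVec (L : Type) (dW c.D 0))
    (fun _ => dW_real c.D 0) (fun _ => dW_ne c.D 0)).CompatibleSplitting)
  (hGR₁ : (cmSplittingDatum (L : Type) (e₁) (frameD V) (frameD_real V) (frameD_ne V) (lineVec (L : Type) (dW c.D 1))
    (fun _ => dW_real c.D 1) (fun _ => dW_ne c.D 1)).CompatibleSplitting)
  (hGR₂ : (cmSplittingDatum (L : Type) (e₁) (frameD V) (frameD_real V) (frameD_ne V) (lineVec (L : Type) (dW' c.D 0))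
    (fun _ => dW'_real c.D 0) (fun _ => dW'_ne c.D 0)).CompatibleSplitting)
  (hGR₃ : (cmSplittingDatum (L : Type) (e₁) (frameD V) (frameD_real V) (frameD_ne V) (lineVec (L : Type) (dW' c.D 1))
    (fun _ => dW'_real c.D 1) (fun _ => dW'_ne c.D 1)).CompatibleSplitting)
  (η : CMAdelic (L : Type) (frameD V) × CMAdelic (L : Type) (dW c.D) →* ℂˣ)
  (hη : ∀ γU ∈ CMRat (L : Type) (frameD V), ∀ γ ∈ CMRat (L : Type) (dW c.D), η (γU, γ) = 1)
  (hηc : Continuous fun p => ((η p : ℂˣ) : ℂ))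
  (h₁W : (∀ j, 0 < (ι₁ (dW c.D j)).re) ∨ ∀ j, (ι₁ (dW c.D j)).re < 0)
  (A : ∀ k : Fin 4, ArchLineInput V (lineRepD V c.D hGR hGR₀ hGR₁ hGR₂ hGR₃ η k))
  (hV : IsAnisotropic L V.Hm)
  (ωar : UnitaryGroup.arch (↥(maximalRealSubfield L)) L (IsCMField.complexConj L) 3 V.Hm →
    (𝓢((Fin 3 → mixedSpace (↥(maximalRealSubfield L))), ℂ) →ₗ[ℂ] 𝓢((Fin 3 → mixedSpace (↥(maximalRealSubfield L))), ℂ)))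

variable
  (Φ₂ : Module.Dual ℂ (Fin 2 → ℂ) →ₗ[ℂ] 𝓢((Fin 3 → mixedSpace (↥(maximalRealSubfield L))), ℂ))
  (harm₂ : ∀ (u : ↥(stabilizer U21 x₀)) (ℓ : Module.Dual ℂ (Fin 2 → ℂ)),
    lineOmega_two V c.D hGR hGR₂ hGR₃ (eta₂ V c.D η) (u : U21) (Φ₂ ℓ) =
      Φ₂ ((BallForms.isPullbackCocycle_cotangentCocycle.weightOf x₀).dual u ℓ))
  (hdef₂ : ∀ a : UnitaryGroup.arch (↥(maximalRealSubfield L)) L (IsCMField.complexConj L) 3 V.Hm,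
    UnitaryGroup.archAt (↥(maximalRealSubfield L)) L (IsCMField.complexConj L) 3 V.Hm (UnitaryGroup.cmPlace (L : Type) ι₁)
        (NumberField.complexConj_smul_infinitePlace (L : Type) _) (IsCMField.complexConj_ne_one (L : Type)) a = 1 →
    ∀ (ℓ : Module.Dual ℂ (Fin 2 → ℂ)) (Φf : FinSB (↥(maximalRealSubfield L)) (Fin 3)),
      lineRepOf V c.D hGR hGR₀ hGR₁ hGR₂ hGR₃ (eta₀ V c.D η) (eta₁ V c.D η) (eta₂ V c.D η) (eta₃ V c.D η) 2
          (HodgeCM.Adelic.regimeEquiv L V.Hm hV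
            (UnitaryGroup.archToAdelic (↥(maximalRealSubfield L)) L (IsCMField.complexConj L) 3 V.Hm a), 1)
          (piSchwartzBruhatEquiv (↥(maximalRealSubfield L)) (Fin 3) (Φ₂ ℓ ⊗ₜ[ℂ] Φf)) =
        piSchwartzBruhatEquiv (↥(maximalRealSubfield L)) (Fin 3) (Φ₂ ℓ ⊗ₜ[ℂ] Φf))
  (Φ₃ : Module.Dual ℂ (Fin 2 → ℂ) →ₗ[ℂ] 𝓢((Fin 3 → mixedSpace (↥(maximalRealSubfield L))), ℂ))
  (harm₃ : ∀ (u : ↥(stabilizer U21 x₀)) (ℓ : Module.Dual ℂ (Fin 2 → ℂ)),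
    lineOmega_three V c.D hGR hGR₂ hGR₃ (eta₃ V c.D η) (u : U21) (Φ₃ ℓ) =
      Φ₃ ((BallForms.isPullbackCocycle_cotangentCocycle.weightOf x₀).dual u ℓ))
  (hdef₃ : ∀ a : UnitaryGroup.arch (↥(maximalRealSubfield L)) L (IsCMField.complexConj L) 3 V.Hm,
    UnitaryGroup.archAt (↥(maximalRealSubfield L)) L (IsCMField.complexConj L) 3 V.Hm (UnitaryGroup.cmPlace (L : Type) ι₁)
        (NumberField.complexConj_smul_infinitePlace (L : Type) _) (IsCMField.complexConj_ne_one (L : Type)) a = 1 →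
    ∀ (ℓ : Module.Dual ℂ (Fin 2 → ℂ)) (Φf : FinSB (↥(maximalRealSubfield L)) (Fin 3)),
      lineRepOf V c.D hGR hGR₀ hGR₁ hGR₂ hGR₃ (eta₀ V c.D η) (eta₁ V c.D η) (eta₂ V c.D η) (eta₃ V c.D η) 3
          (HodgeCM.Adelic.regimeEquiv L V.Hm hV
            (UnitaryGroup.archToAdelic (↥(maximalRealSubfield L)) L (IsCMField.complexConj L) 3 V.Hm a), 1)
          (piSchwartzBruhatEquiv (↥(maximalRealSubfield L)) (Fin 3) (Φ₃ ℓ ⊗ₜ[ℂ] Φf)) =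
        piSchwartzBruhatEquiv (↥(maximalRealSubfield L)) (Fin 3) (Φ₃ ℓ ⊗ₜ[ℂ] Φf))

/-- **`hrk` OF SLOT 2 IS A THEOREM, for every `(ωar, har)`** (#CA64 `rank_le_one_of_lineOmega_two`). -/
theorem rank_admFamilies_thetaDistDatumTwoOf_le_one
    (har : ∀ aa : UnitaryGroup.arch (↥(maximalRealSubfield L)) L (IsCMField.complexConj L) 3 V.Hm,
      UnitaryGroup.archAt (↥(maximalRealSubfield L)) L (IsCMField.complexConj L) 3 V.Hm (UnitaryGroup.cmPlace (L : Type) ι₁)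
          (NumberField.complexConj_smul_infinitePlace (L : Type) _) (IsCMField.complexConj_ne_one (L : Type)) aa = 1 →
      ((archSideOf V c hGR hGR₀ hGR₁ hGR₂ hGR₃ η hη hηc h₁W A).P 2).ω
          (HodgeCM.Adelic.regimeEquiv L V.Hm hV
            (UnitaryGroup.archToAdelic (↥(maximalRealSubfield L)) L (IsCMField.complexConj L) 3 V.Hm aa), 1) =
        adelicTensorEnd (K := ↥(maximalRealSubfield L)) (ι := Fin 3) (ωar aa) LinearMap.id) :
    Module.rank ℂ ↥((thetaDistDatumTwoOf V c hGR hGR₀ hGR₁ hGR₂ hGR₃ η hη hηc h₁W A hV Φ₂ harm₂ hdef₂).admFamilies ωar) ≤ 1 :=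
  rank_le_one_of_lineOmega_two V c.D hGR hGR₀ hGR₁ hGR₂ hGR₃ (eta₀ V c.D η) (eta₁ V c.D η) (eta₂ V c.D η) (eta₃ V c.D η) hV ωar _
    har (fun _ ha => ha.1) (fun _ ha => ha.2)

/-- **`hrk` OF SLOT 3 IS A THEOREM, for every `(ωar, har)`** (#CA64 `rank_le_one_of_lineOmega_three`). -/
theorem rank_admFamilies_thetaDistDatumThreeOf_le_one
    (har : ∀ aa : UnitaryGroup.arch (↥(maximalRealSubfield L)) L (IsCMField.complexConj L) 3 V.Hm,
      UnitaryGroup.archAt (↥(maximalRealSubfield L)) L (IsCMField.complexConj L) 3 V.Hm (UnitaryGroup.cmPlace (L : Type) ι₁)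
          (NumberField.complexConj_smul_infinitePlace (L : Type) _) (IsCMField.complexConj_ne_one (L : Type)) aa = 1 →
      ((archSideOf V c hGR hGR₀ hGR₁ hGR₂ hGR₃ η hη hηc h₁W A).P 3).ω
          (HodgeCM.Adelic.regimeEquiv L V.Hm hV
            (UnitaryGroup.archToAdelic (↥(maximalRealSubfield L)) L (IsCMField.complexConj L) 3 V.Hm aa), 1) =
        adelicTensorEnd (K := ↥(maximalRealSubfield L)) (ι := Fin 3) (ωar aa) LinearMap.id) :
    Module.rank ℂ ↥((thetaDistDatumThreeOf V c hGR hGR₀ hGR₁ hGR₂ hGR₃ η hη hηc h₁W A hV Φ₃ harm₃ hdef₃).admFamilies ωar) ≤ 1 :=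
  rank_le_one_of_lineOmega_three V c.D hGR hGR₀ hGR₁ hGR₂ hGR₃ (eta₀ V c.D η) (eta₁ V c.D η) (eta₂ V c.D η) (eta₃ V c.D η) hV ωar _
    har (fun _ ha => ha.1) (fun _ ha => ha.2)

end Honest34

end ThetaAdelicSide
end HodgeCM.Model
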